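import Summits.Ventures.CertifiedManyBodySolver.Downfold.EmeryAntibondingBandContinuous
import HarnessLib

/-!
# THE FERMI ENERGY AS A FUNCTION OF THE FILLING: `fermiEnergyOf Δ t_pd t_pp t_pp′ ν` — the unique energy of filling `ν`, its
# certified bracket, its monotonicity in the doping, and the census theorems AT it

Venture CertifiedManyBodySolver, cell `pub/hubbard-downfold` (stage S1; INFLATION-RULES-3to1-B §B.82 (l)), seat hubbard-downfold-mod-4 (technique
B, g34); namespace `Summit.Ventures.CertifiedManyBodySolver.Downfold.Emery`. Everything PROVED (0 sorry). WHAT THIS IS NOT: a statement about any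
material; `U = 0` one-body kinematics of the σ (d–p_x–p_y + t_pp, t_pp′) model (rigid band); no number lives here.

`EmeryFermiEnergyExists` (existence) and `EmeryAntibondingBandContinuous` (uniqueness) make «the Fermi energy of a σ row at filling ν» a
single real number; this file NAMES it so that downstream statements can be written as functions of the doping `x` (`ν = (1 − x)/2`)
instead of being quantified over «every ε with abFilling ε = ν»:

* §1 `fermiEnergyOf Δ t_pd t_pp t_pp′ ν := sInf {ε ≥ 0 | ν ≤ abFilling ε}` — the least non-negative energy whose filling reaches `ν`.
  For `Δ, t_pp, t_pp′ ≥ 0` and `0 < ν < 1`: **if SOME energy has filling `ν` then `fermiEnergyOf ν` is it** (`fermiEnergyOf_eq_of_abFilling_eq`,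
  least-element argument on the strictly increasing filling map), hence `abFilling (fermiEnergyOf ν) = ν` (`abFilling_fermiEnergyOf`).
* §2 THE CERTIFIED BRACKET: a passing `pointBracketCheck` (the `K = 384` census bracket of `EmeryFermiScalePoint`) with `t_pd, t_pp > 0`,
  `t_pp′ ≤ t_pp` gives, for every `ν ∈ [ν₁, ν₂]`, **`abFilling (fermiEnergyOf ν) = ν` and `fermiEnergyOf ν ∈ [e₁, e₂]`**
  (`fermiEnergyOf_of_pointBracketCheck`), and every census conclusion proved «for all ε at filling ν» HOLDS AT `fermiEnergyOf ν`
  (`census_at_fermiEnergyOf`).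
* §3 MONOTONICITY: between two attained fillings the Fermi energy is STRICTLY increasing in `ν` (`fermiEnergyOf_lt_fermiEnergyOf`), i.e.
  STRICTLY DECREASING in the hole doping `x` (`fermiEnergyOf_doping_strictAnti`): doping holes lowers the Fermi energy of the row, with no
  certificate and no width.

Sources: three-band model [HybertsenSchluterChristensen1989, Eq. (1)]; [AndersenEtAl1995, §6]; conditionally complete lattices / least elements
[folklore].
-/

noncomputable section

namespace Summit.Ventures.CertifiedManyBodySolver.Downfold.Emery

open Real MeasureTheory Set

/-! ## §1 The definition and its characterisation -/

/-- **THE FERMI ENERGY OF A σ ROW AT FILLING `ν`** (per spin; `ν = (1 − x)/2` at hole doping `x`): the least non-negative energy whose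
antibonding-band filling `abFilling` reaches `ν`. [cite: HybertsenSchluterChristensen1989, Eq. (1) (three-band d–p model)] -/
def fermiEnergyOf (Δ a b c ν : ℝ) : ℝ := sInf {ε : ℝ | 0 ≤ ε ∧ ν ≤ abFilling Δ a b c ε}

section Spec

variable {Δ a b c : ℝ}

/-- An energy of positive filling is non-negative (`Δ, t_pp, t_pp′ ≥ 0`). [folklore] -/
theorem nonneg_of_abFilling_pos (hΔ : 0 ≤ Δ) (hc : 0 ≤ c) (hb : 0 ≤ b) {ε : ℝ} (h : 0 < abFilling Δ a b c ε) : 0 ≤ ε := by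
  by_contra hlt
  push Not at hlt
  have := abFilling_of_neg (a := a) hΔ hc hb hlt
  linarith

/-- **IF SOME ENERGY HAS FILLING `ν ∈ (0, 1)` THEN `fermiEnergyOf ν` IS THAT ENERGY** (it is the least element of the defining set, by the
strict monotonicity of the filling map on the band). [folklore] -/
theorem fermiEnergyOf_eq_of_abFilling_eq (hΔ : 0 ≤ Δ) (hc : 0 ≤ c) (hb : 0 ≤ b) {ν ε : ℝ} (hν0 : 0 < ν) (hν1 : ν < 1)
    (h : abFilling Δ a b c ε = ν) : fermiEnergyOf Δ a b c ν = ε := by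
  have hε0 : 0 ≤ ε := nonneg_of_abFilling_pos (a := a) hΔ hc hb (by rw [h]; exact hν0)
  refine IsLeast.csInf_eq ⟨⟨hε0, h.ge⟩, fun ε' hε' => ?_⟩
  by_contra hlt
  push Not at hlt
  obtain ⟨k, hk, hkE⟩ := exists_gt_of_abFilling_lt_one (Δ := Δ) (a := a) (b := b) (c := c) (ε := ε) (by rw [h]; exact hν1)
  have := abFilling_lt_abFilling hΔ hc hb hε'.1 hlt hk hkE.le
  linarith [hε'.2]

/-- Hence `abFilling (fermiEnergyOf ν) = ν` as soon as the filling `ν ∈ (0, 1)` is attained. [folklore] -/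
theorem abFilling_fermiEnergyOf (hΔ : 0 ≤ Δ) (hc : 0 ≤ c) (hb : 0 ≤ b) {ν : ℝ} (hν0 : 0 < ν) (hν1 : ν < 1)
    (hex : ∃ ε : ℝ, abFilling Δ a b c ε = ν) : abFilling Δ a b c (fermiEnergyOf Δ a b c ν) = ν := by
  obtain ⟨ε, h⟩ := hex
  rw [fermiEnergyOf_eq_of_abFilling_eq hΔ hc hb hν0 hν1 h]; exact h

/-- The Fermi energy of an attained filling `ν ∈ (0, 1)` is non-negative. [folklore] -/
theorem fermiEnergyOf_nonneg (hΔ : 0 ≤ Δ) (hc : 0 ≤ c) (hb : 0 ≤ b) {ν : ℝ} (hν0 : 0 < ν) (hν1 : ν < 1)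
    (hex : ∃ ε : ℝ, abFilling Δ a b c ε = ν) : 0 ≤ fermiEnergyOf Δ a b c ν :=
  nonneg_of_abFilling_pos (a := a) hΔ hc hb (by rw [abFilling_fermiEnergyOf hΔ hc hb hν0 hν1 hex]; exact hν0)

/-- Any census conclusion «for every ε at filling ν» holds AT `fermiEnergyOf ν` once `ν ∈ (0, 1)` is attained. [folklore] -/
theorem at_fermiEnergyOf_of_forall (hΔ : 0 ≤ Δ) (hc : 0 ≤ c) (hb : 0 ≤ b) {ν : ℝ} (hν0 : 0 < ν) (hν1 : ν < 1)
    (hex : ∃ ε : ℝ, abFilling Δ a b c ε = ν) {P : ℝ → Prop} (hP : ∀ ε : ℝ, abFilling Δ a b c ε ∈ Icc ν ν → P ε) :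
    P (fermiEnergyOf Δ a b c ν) := by
  have h := abFilling_fermiEnergyOf hΔ hc hb hν0 hν1 hex
  exact hP _ ⟨h.ge, h.le⟩

end Spec

/-! ## §2 The certified bracket -/

/-- **THE FERMI ENERGY OF A CERTIFIED WINDOW**: a passing `pointBracketCheck` with `t_pd, t_pp > 0`, `t_pp′ ≤ t_pp` ⇒ for every
`ν ∈ [ν₁, ν₂]`: `abFilling (fermiEnergyOf ν) = ν` and `fermiEnergyOf ν ∈ [e₁, e₂]`. [folklore] -/
theorem fermiEnergyOf_of_pointBracketCheck {Δ a b c e₁ e₂ ν₁ ν₂ : ℚ} {jout jin : List ℕ}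
    (h : pointBracketCheck Δ a b c e₁ e₂ ν₁ ν₂ jout jin = true) (ha : 0 < a) (hb : 0 < b) (hcb : c ≤ b)
    {ν : ℝ} (hν : ν ∈ Icc (ν₁ : ℝ) ν₂) :
    abFilling Δ a b c (fermiEnergyOf Δ a b c ν) = ν ∧ fermiEnergyOf (Δ : ℝ) a b c ν ∈ Icc (e₁ : ℝ) e₂ := by
  obtain ⟨⟨ε, hε, huniq⟩, hbr⟩ := existsUnique_fermiEnergy_of_pointBracketCheck h ha hb hcb hν
  have h' := h
  simp only [pointBracketCheck, Bool.and_eq_true, decide_eq_true_eq] at h'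
  obtain ⟨⟨⟨⟨⟨⟨⟨⟨⟨⟨⟨⟨⟨-, -⟩, hΔ⟩, -⟩, hb0⟩, hc⟩, -⟩, -⟩, -⟩, -⟩, -⟩, -⟩, -⟩, -⟩ := h'
  -- ν ∈ (0, 1): from the bracket of ε and the two certified counts, via the uniqueness theorem's consequences
  have hν0 : 0 < ν := by
    by_contra hle
    push Not at hle
    -- abFilling (-1) = 0 ≥ ν would make −1 a second solution unless ν < 0 … use: ε ∈ [e₁, e₂] with e₁ ≥ 0 and filling ν ≤ 0 ⇒ ν = 0;
    -- then every negative energy also has filling 0 = ν, contradicting uniqueness.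
    have hfill0 : abFilling (Δ : ℝ) a b c (-1) = 0 :=
      abFilling_of_neg (by exact_mod_cast hΔ) (by exact_mod_cast hc) (by exact_mod_cast hb0) (by norm_num)
    have hνnn : 0 ≤ ν := by rw [← hε]; exact abFilling_nonneg _ _ _ _ _
    have hν00 : ν = 0 := le_antisymm hle hνnn
    have h1 := huniq (-1) (show abFilling (Δ : ℝ) a b c (-1) = ν by rw [hfill0, hν00])
    have hfill2 : abFilling (Δ : ℝ) a b c (-2) = 0 :=
      abFilling_of_neg (by exact_mod_cast hΔ) (by exact_mod_cast hc) (by exact_mod_cast hb0) (by norm_num)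
    have h2 := huniq (-2) (show abFilling (Δ : ℝ) a b c (-2) = ν by rw [hfill2, hν00])
    linarith
  have hν1 : ν < 1 := by
    by_contra hge
    push Not at hge
    have hle1 : ν ≤ 1 := by rw [← hε]; exact abFilling_le_one _ _ _ _ _
    have hν11 : ν = 1 := le_antisymm hle1 hge
    -- abFilling is monotone and ≤ 1: every energy above ε also has filling 1 — contradicting uniqueness
    have hmono := abFilling_mono (Δ : ℝ) a b c (show ε ≤ ε + 1 by linarith)
    have h1 : abFilling (Δ : ℝ) a b c (ε + 1) = ν :=
      le_antisymm (by rw [hν11]; exact abFilling_le_one _ _ _ _ _) (by rw [← hε]; exact hmono)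
    have := huniq (ε + 1) (show abFilling (Δ : ℝ) a b c (ε + 1) = ν from h1)
    linarith
  have hΔr : (0 : ℝ) ≤ Δ := by exact_mod_cast hΔ
  have hcr : (0 : ℝ) ≤ c := by exact_mod_cast hc
  have hbr' : (0 : ℝ) ≤ b := by exact_mod_cast hb0
  have heq := fermiEnergyOf_eq_of_abFilling_eq hΔr hcr hbr' hν0 hν1 hε
  refine ⟨by rw [heq]; exact hε, by rw [heq]; exact hbr ε hε⟩

/-- **CENSUS THEOREMS HOLD AT `fermiEnergyOf ν`**: with a passing `pointBracketCheck`, any conclusion proved «for every ε with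
`abFilling ε ∈ [ν, ν]`» holds at the row's Fermi energy `fermiEnergyOf ν`, which lies in `[e₁, e₂]`. [folklore] -/
theorem census_at_fermiEnergyOf {Δ a b c e₁ e₂ ν₁ ν₂ : ℚ} {jout jin : List ℕ}
    (h : pointBracketCheck Δ a b c e₁ e₂ ν₁ ν₂ jout jin = true) (ha : 0 < a) (hb : 0 < b) (hcb : c ≤ b)
    {ν : ℝ} (hν : ν ∈ Icc (ν₁ : ℝ) ν₂) {P : ℝ → Prop} (hP : ∀ ε : ℝ, abFilling Δ a b c ε ∈ Icc ν ν → P ε) :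
    P (fermiEnergyOf Δ a b c ν) ∧ fermiEnergyOf (Δ : ℝ) a b c ν ∈ Icc (e₁ : ℝ) e₂ := by
  obtain ⟨hfill, hmem⟩ := fermiEnergyOf_of_pointBracketCheck h ha hb hcb hν
  exact ⟨hP _ ⟨hfill.ge, hfill.le⟩, hmem⟩

/-! ## §3 Monotonicity in the filling / the doping -/

section Mono

variable {Δ a b c : ℝ}

/-- **THE FERMI ENERGY IS STRICTLY INCREASING IN THE FILLING** (between attained fillings in `(0, 1)`). [folklore] -/
theorem fermiEnergyOf_lt_fermiEnergyOf (hΔ : 0 ≤ Δ) (hc : 0 ≤ c) (hb : 0 ≤ b) {ν ν' : ℝ} (hν0 : 0 < ν) (hνν' : ν < ν') (hν'1 : ν' < 1)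
    (hex : ∃ ε : ℝ, abFilling Δ a b c ε = ν) (hex' : ∃ ε : ℝ, abFilling Δ a b c ε = ν') :
    fermiEnergyOf Δ a b c ν < fermiEnergyOf Δ a b c ν' := by
  have h1 := abFilling_fermiEnergyOf hΔ hc hb hν0 (hνν'.trans hν'1) hex
  have h2 := abFilling_fermiEnergyOf hΔ hc hb (hν0.trans hνν') hν'1 hex'
  by_contra hle
  push Not at hle
  have := abFilling_mono Δ a b c hle
  linarith

/-- **DOPING HOLES LOWERS THE FERMI ENERGY, STRICTLY**: for hole dopings `x < x'` (both in `(−1, 1)`, both attained),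
`ε_F(x') < ε_F(x)` where `ε_F(x) = fermiEnergyOf ((1 − x)/2)`. [folklore] -/
theorem fermiEnergyOf_doping_strictAnti (hΔ : 0 ≤ Δ) (hc : 0 ≤ c) (hb : 0 ≤ b) {x x' : ℝ} (hx : -1 < x) (hxx' : x < x') (hx' : x' < 1)
    (hex : ∃ ε : ℝ, abFilling Δ a b c ε = (1 - x) / 2) (hex' : ∃ ε : ℝ, abFilling Δ a b c ε = (1 - x') / 2) :
    fermiEnergyOf Δ a b c ((1 - x') / 2) < fermiEnergyOf Δ a b c ((1 - x) / 2) :=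
  fermiEnergyOf_lt_fermiEnergyOf hΔ hc hb (by linarith) (by linarith) (by linarith) hex' hex

/-- The Fermi energy is (weakly) monotone in the filling between attained fillings in `(0, 1)`. [folklore] -/
theorem fermiEnergyOf_le_fermiEnergyOf (hΔ : 0 ≤ Δ) (hc : 0 ≤ c) (hb : 0 ≤ b) {ν ν' : ℝ} (hν0 : 0 < ν) (hνν' : ν ≤ ν') (hν'1 : ν' < 1)
    (hex : ∃ ε : ℝ, abFilling Δ a b c ε = ν) (hex' : ∃ ε : ℝ, abFilling Δ a b c ε = ν') :
    fermiEnergyOf Δ a b c ν ≤ fermiEnergyOf Δ a b c ν' := by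
  rcases hνν'.lt_or_eq with hlt | heq
  · exact (fermiEnergyOf_lt_fermiEnergyOf hΔ hc hb hν0 hlt hν'1 hex hex').le
  · rw [heq]

end Mono

end Summit.Ventures.CertifiedManyBodySolver.Downfold.Emery
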